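/-
Origin: expansion seat `prover-pub-hodgecm-mc-binder-1-g2-0`, handover #1 2026-08-18T20:21Z md5 f871b65069bcdc1158c0645b258313bc (NEW, 329 l.; rewrites import McB1g2.EndStateMeet -> HodgeCM.Model.EndStateMeet x1 (and the Origin header sentence naming the overlay import); 12 decls, #print axioms trio 12/12 (scratch lean/McB1g2/AxiomsMB.scratch.lean, NOT handed); audited names: HodgeCM.Universe.ThetaModel.gen12MeetAt_of_funBridge, HodgeCM.Universe.ThetaModel.real34Meet (`HOME/mc/pub-hodgecm-mc-binder-1/lean/McB1g2/MeetBridges.lean`, md5 f871b650, 329 lines);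
landed by the packager successor (mc-unitary-1-g3, gen-8 kit) in gate run 32 as `HodgeCM/Model/Binders/MeetBridges.lean` (import ^import McB1g2\.EndStateMeet\b→import HodgeCM.Model.EndStateMeet ×1).
-/
/-
Origin: speedrun cell pub-hodgecm, MODEL-CONSTRUCTION sub-cell, unit pub-hodgecm-mc-binder-1-g2 (BINDER PROVER hbr/hQ/hch,
gen 2; node B2-meet = rows hbr/hQ under the ₁₀ end state), seat prover-pub-hodgecm-mc-binder-1-g2-0, 2026-08-18.
Target in PKG: HodgeCM/Model/Binders/MeetBridges.lean (NEW additive leaf; imports E4 = prl1-g11 kit row #5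
`HodgeCM/Model/EndStateMeet.lean` only; nothing landed imports it).  In this staging copy the import is the seat-prefixed
overlay module `McB1g2.EndStateMeet` (= E4 bytes 36df9bfc95bc with its own import re-prefixed); the packager rewrites the
one import line to `HodgeCM.Model.EndStateMeet`.
KERNEL ONLY: every declaration below is proved from the package as it stands; 0 records asserted, 0 cited hypotheses,
MODEL-N 0.  `#print axioms` of every theorem = [propext, Classical.choice, Quot.sound].
-/
import Summits.HodgeConjecture.HodgeCM.Model.EndStateMeet_2

/-!
# B2-meet — the binders hbr / hQ under the ₁₀ end state: FUNCTION-LEVEL bridge records for C5′ / C6′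

Rows hbr (`Nonempty (SeesawBridge …)`, leaf N19w) and hQ (`Nonempty (QautBridge …)`, leaf N19g) of
`EndStateThm44.endState_conclusions` were discharged, on the E0 path, through records whose last fields are
EQUALITIES / MEMBERSHIPS in `HG = L²([G_U])` between a wedge-function `T.Λ Γ ω ω'` and a (limit of) theta lift(s)
(`SeesawBridge.Λ_wedge`, `QautBridge.wedge_mem`).  For the geometric model those fields are support-sensitive (the
wedge-functions are PIECE-SUPPORTED, the theta lifts live on all of `[G_U]`; prl1-g11 HAZARD C5/C6, referee A ROUND 30,
BINDER-TRIAGE §17) and the end state of record became E4 = `Assembly.perL_ofSignRecipe₁₀` over the six-input record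
`ThetaModel.AllCharsNonDesignPt₂` whose theta-meeting inputs are

* C5′ `ThetaModel.Gen12MeetAt V c` (hbr's successor) and
* C6′ `ThetaModel.Real34MeetAt V c` (hQ's successor);

hch (`Open_chars`) is NOT an input of this record (all-characters cut).

This file types, for the binder prover's two rows, the FUNCTION-LEVEL bridge records that replace `SeesawBridge` /
`QautBridge` on the ₁₀ path — each field is one named obligation of the constructed model, labelled with the node /
seat that supplies it — and proves that they imply C5′ / C6′ (`gen12MeetAt_of_funBridge`,
`real34MeetAt_of_funBridge`), assembles the six-input record from them (`AllCharsNonDesignPt₂.ofFunBridges`) and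
restates the headline (`Assembly.perL_ofFunBridges₁₀`).  The E0 generator identity still gives the C5′ bridge
(`Gen12FunBridge.ofGenIdentity`: the record is CONSERVATIVE over the old route); `Λ_pullC_cover` records the
`Fact_pull_cup` rewrite of the (12)-side used by the meeting lemma.

DICTIONARY (PerL v5 tex `…paper-v5-d912a121.tex`): (eq:Qaut) l. 249; theta forms §3.2 ll. 258–268; (eq:seesaw)
ll. 323–325; Lemma 3.5 ll. 350–379 ((12) = (w)-direction ll. 372–375, (34) = (gen ⊆)-direction ll. 356–372);
Thm 4.4 Steps 2–3 = what is consumed (E4 module docstring).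

WHAT EACH FIELD ASKS OF THE CONSTRUCTED MODEL (owner nodes as of MODEL-DAG v0.13.1 / STATUS 20:15Z):
* `Gen12FunBridge.wf` — the GLOBAL (12)-wedge-function of two theta one-forms (for one-forms attached to theta SERIES
  `θ₁ = θ(φ₁, χ′₁)`, `θ₂ = θ(φ₂, χ′₂)`: the function `θ₁¹θ₂² − θ₁²θ₂¹` of (eq:Qaut) on ALL of `[G_U]`) — a DATUM of
  dictionary D2 (`Theta` := classes of theta one-forms; emb-instance / W6b-3 seat).
* `Gen12FunBridge.wf_gen` — SEESAW at function level: that global wedge-function IS a (12)-theta lift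
  `ϑ₁₂(χ, Φ)` ((eq:seesaw) for split data + additivity; PRINT: Kudla splitting multiplicativity [HKS96 Cor. A.3],
  [Kudla, Israel J. Math. 87 (1994) §3] — KERNEL mod print in PKG `HKSDescent.jt_compat`, `Seesaw.eq_seesaw`,
  `SeesawWedge.genIdentity_core`; tree Fubini `SeesawTorus.integral_mul_char` p178002; theta-series product
  `Weil1964/ThetaSeriesProduct` ; W2 multiplicativity of the constructed `wm`).
* `Gen12FunBridge.proj` — PIECE PROJECTION: `⟪Λ_Γ(ω₁, ω₂), wf⟫ = a · ⟪Λ, Λ⟫` with `a ≠ 0` (D5 `emb Γ = c_Γ • pieceEmb ∘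
  formOf` + tree single-piece unfolding `⟪pieceLiftLp (pieceDescendCM F), F⟫ = ‖pieceLiftLp (pieceDescendCM F)‖²`
  (prl1-g12 `LevelOrbitUnfolding`, claimed 20:10:20Z) through glue-1's junction `QuotientModel.pieceEmb` (kit #29);
  `Gen12FunBridge.proj_of_eq_smul` below turns exactly that shape into the field).
* `Real34FunBridge.wset` / `gen_mem` — Lemma 3.5 (34) in FUNCTION form: every (34)-theta lift of `𝒮^κ`-data lies in
  the closed span of the GLOBAL (34)-wedge-functions (density of `pr_κ(𝒫)`, the `K_{ι₁}`-type count, (eq:seesaw); PRINT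
  [Weil 1964 n° 39/41], [Ichino 2022 §4.1/L7.10] (tree `Ichino2022/*`, gen 1), [BW VI 4.11]; KERNEL in PKG `Qaut.*`,
  `QautWedge`, `FockKTypes`, `S5QautFock*` — the analytic content of hQ, unchanged and NOT support-sensitive).
* `Real34FunBridge.meet` — MEETING + PROJECTION at the met level (tree meeting lemma `LevelOrbitMeeting`,
  mc-autform-2-g2, claimed 20:12:25Z: sub-piece localisation, substitution `g = hk`, conjugation to the base point;
  prl1-g12's projection identity; the restricted translated theta series `θ(χ₃, ω(k)Φ₃)`, `θ(χ₄, ω(k)Φ₄)` are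
  `U_Ψ`-classes at `Γ' ≤ Γ₁` (the membership lemma behind C3) and the (12)-classes are pulled back along `T.cover` —
  `Real34FunBridge.meet_of_cover` below is that shape, using `Universe.pullC_mem_Uiso` over `Fact_pull_comp`;
  `Real34FunBridge.meet_of_theta` is the variant with theta one-forms of the model at `Γ'` + C3).  As in E4 only
  `U_Ψ`-membership is asked at the met level, so the model's level groups `K_Γ` and the meeting lemma's sub-piece
  groups `K₁ ∩ kK_Pk⁻¹` need not agree.
Nothing here is a hypothesis of PerL beyond what E4 already demands: the records only SPLIT C5′ / C6′ into the parts
the construction seats deliver by name.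
-/

noncomputable section

open scoped InnerProductSpace

namespace HodgeCM

open HodgeCM.Prior.Perl34File

namespace Universe

namespace ThetaModel

variable {U : Universe} (T : U.ThetaModel)

/-! ## 1. C5′ — the (12) function-level bridge (row hbr under ₁₀) -/

/-- **Function-level (12)-bridge at `(V, c)`** (row hbr on the ₁₀ path).  Data: the GLOBAL wedge-function
`wf Γ ω₁ ω₂ ∈ HG` of two degree-one classes at level `Γ`.  Obligations, for theta one-forms `ω₁ ∈ Θ₀(Γ)`,
`ω₂ ∈ Θ₁(Γ)`: `wf_gen` — the global wedge-function is a (12)-theta lift (SEESAW, PerL (eq:seesaw) + Lemma 3.5 (12));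
`proj` — the model's wedge-function `Λ_Γ(ω₁, ω₂)` pairs with it as a non-zero multiple of `⟪Λ, Λ⟫` (PIECE
PROJECTION / unfolding).  Values of `wf` off theta one-forms are irrelevant. -/
structure Gen12FunBridge {L : CMField} {ι₁ : L →+* ℂ} (V : HermSpace3 L ι₁) (c : SeesawCtx L) where
  /-- the global (12)-wedge-function of two degree-one classes at level `Γ` (D2 datum) -/
  wf : ∀ Γ : Level V, U.CohC (U.pms L ι₁ V Γ) 1 → U.CohC (U.pms L ι₁ V Γ) 1 → T.HG L ι₁ V
  /-- SEESAW, function level: for theta one-forms the global wedge-function IS a (12)-theta lift -/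
  wf_gen : ∀ (Γ : Level V) (ω₁ ω₂ : U.CohC (U.pms L ι₁ V Γ) 1), ω₁ ∈ T.Theta V c 0 Γ → ω₂ ∈ T.Theta V c 1 Γ →
    ∃ (χ : (T.t12 V c).X) (Φ : T.SK V c), wf Γ ω₁ ω₂ = (T.t12 V c).ϑ χ Φ
  /-- PIECE PROJECTION: `⟪Λ_Γ(ω₁, ω₂), wf⟫ = a · ⟪Λ_Γ(ω₁, ω₂), Λ_Γ(ω₁, ω₂)⟫` for some `a ≠ 0` -/
  proj : ∀ (Γ : Level V) (ω₁ ω₂ : U.CohC (U.pms L ι₁ V Γ) 1), ω₁ ∈ T.Theta V c 0 Γ → ω₂ ∈ T.Theta V c 1 Γ →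
    ∃ a : ℂ, a ≠ 0 ∧ ⟪T.Λ Γ ω₁ ω₂, wf Γ ω₁ ω₂⟫_ℂ = a * ⟪T.Λ Γ ω₁ ω₂, T.Λ Γ ω₁ ω₂⟫_ℂ

/-- **C5′ from the function-level (12)-bridge**: a non-zero wedge of theta one-forms pairs non-trivially with the
(12)-theta lift that its global wedge-function is. -/
theorem gen12MeetAt_of_funBridge {L : CMField} {ι₁ : L →+* ℂ} {V : HermSpace3 L ι₁} {c : SeesawCtx L}
    (B : T.Gen12FunBridge V c) : T.Gen12MeetAt V c := by
  intro Γ ω₁ ω₂ h₁ h₂ hne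
  obtain ⟨χ, Φ, hgen⟩ := B.wf_gen Γ ω₁ ω₂ h₁ h₂
  obtain ⟨a, ha, hproj⟩ := B.proj Γ ω₁ ω₂ h₁ h₂
  refine ⟨χ, Φ, ?_⟩
  rw [← hgen, hproj]
  exact mul_ne_zero ha (inner_self_ne_zero.mpr hne)

/-- `Nonempty` form of `gen12MeetAt_of_funBridge`. -/
theorem gen12MeetAt_of_nonempty_funBridge {L : CMField} {ι₁ : L →+* ℂ} {V : HermSpace3 L ι₁} {c : SeesawCtx L}
    (h : Nonempty (T.Gen12FunBridge V c)) : T.Gen12MeetAt V c :=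
  h.elim fun B => T.gen12MeetAt_of_funBridge B

/-- **The shape the unfolding delivers gives `proj`**: if `Λ = c • p` with `c ≠ 0` and `⟪p, w⟫ = ⟪p, p⟫` (tree:
`⟪pieceLiftLp (pieceDescendCM F), F⟫ = ‖pieceLiftLp (pieceDescendCM F)‖²`, with `p` the piece-projection of the global
function `w` and `c = c_Γ` the model's embedding constant), then `⟪Λ, w⟫ = c⁻¹ · ⟪Λ, Λ⟫`. -/
theorem inner_eq_mul_inner_self_of_eq_smul {E : Type*} [NormedAddCommGroup E] [InnerProductSpace ℂ E]
    {Λ p w : E} {c : ℂ} (hc : c ≠ 0) (hΛ : Λ = c • p) (hp : ⟪p, w⟫_ℂ = ⟪p, p⟫_ℂ) :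
    ⟪Λ, w⟫_ℂ = c⁻¹ * ⟪Λ, Λ⟫_ℂ := by
  subst hΛ
  rw [inner_smul_left, hp, inner_smul_left, inner_smul_right]
  have h : c⁻¹ * ((starRingEnd ℂ) c * (c * ⟪p, p⟫_ℂ)) = (c⁻¹ * c) * ((starRingEnd ℂ) c * ⟪p, p⟫_ℂ) := by ring
  rw [h, inv_mul_cancel₀ hc, one_mul]

/-- Constructor of the `proj` field from the unfolding shape (`Λ_Γ(ω₁, ω₂) = c • p`, `c ≠ 0`, `⟪p, wf⟫ = ⟪p, p⟫`). -/
theorem Gen12FunBridge.proj_of_eq_smul {L : CMField} {ι₁ : L →+* ℂ} {V : HermSpace3 L ι₁} {c : SeesawCtx L}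
    (wf : ∀ Γ : Level V, U.CohC (U.pms L ι₁ V Γ) 1 → U.CohC (U.pms L ι₁ V Γ) 1 → T.HG L ι₁ V)
    (h : ∀ (Γ : Level V) (ω₁ ω₂ : U.CohC (U.pms L ι₁ V Γ) 1), ω₁ ∈ T.Theta V c 0 Γ → ω₂ ∈ T.Theta V c 1 Γ →
      ∃ (a : ℂ) (p : T.HG L ι₁ V), a ≠ 0 ∧ T.Λ Γ ω₁ ω₂ = a • p ∧ ⟪p, wf Γ ω₁ ω₂⟫_ℂ = ⟪p, p⟫_ℂ) :
    ∀ (Γ : Level V) (ω₁ ω₂ : U.CohC (U.pms L ι₁ V Γ) 1), ω₁ ∈ T.Theta V c 0 Γ → ω₂ ∈ T.Theta V c 1 Γ →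
      ∃ a : ℂ, a ≠ 0 ∧ ⟪T.Λ Γ ω₁ ω₂, wf Γ ω₁ ω₂⟫_ℂ = a * ⟪T.Λ Γ ω₁ ω₂, T.Λ Γ ω₁ ω₂⟫_ℂ := by
  intro Γ ω₁ ω₂ h₁ h₂
  obtain ⟨a, p, ha, hΛ, hp⟩ := h Γ ω₁ ω₂ h₁ h₂
  exact ⟨a⁻¹, inv_ne_zero ha, inner_eq_mul_inner_self_of_eq_smul ha hΛ hp⟩

/-- **The record is conservative over the E0 route**: the (12) seesaw-generator IDENTITY of the E0 bridge
(`SeesawBridge.Λ_wedge` / `N19w_genIdentity` shape: `Λ_Γ(ω₁, ω₂) = ϑ₁₂(χ, Φ)`) gives a function-level bridge with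
`wf := Λ` and `a = 1`. -/
def Gen12FunBridge.ofGenIdentity {L : CMField} {ι₁ : L →+* ℂ} {V : HermSpace3 L ι₁} {c : SeesawCtx L}
    (hgen : ∀ (Γ : Level V) (ω₁ ω₂ : U.CohC (U.pms L ι₁ V Γ) 1), ω₁ ∈ T.Theta V c 0 Γ → ω₂ ∈ T.Theta V c 1 Γ →
      ∃ (χ : (T.t12 V c).X) (Φ : T.SK V c), T.Λ Γ ω₁ ω₂ = (T.t12 V c).ϑ χ Φ) :
    T.Gen12FunBridge V c where
  wf Γ ω₁ ω₂ := T.Λ Γ ω₁ ω₂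
  wf_gen := hgen
  proj _ _ _ _ _ := ⟨1, one_ne_zero, (one_mul _).symm⟩

/-! ## 2. C6′ — the (34) function-level bridge (row hQ under ₁₀) -/

/-- **Function-level (34)-bridge at `(V, c)`** (row hQ on the ₁₀ path).  Data: the set `wset ⊆ HG` of GLOBAL
(34)-wedge-functions.  Obligations: `gen_mem` — every (34)-theta lift of `𝒮^κ`-data lies in the closed span of
`wset` (PerL Lemma 3.5 (34) in FUNCTION form: density + `K_{ι₁}`-types + (eq:seesaw)); `meet` — a (12)-wedge of
`U_Ψ`-classes at `Γ₁` pairing non-trivially with some `P ∈ wset` pairs non-trivially, at SOME level `Γ`, with a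
(34)-wedge of `U_Ψ`-classes against a (12)-wedge of `U_Ψ`-classes (= the conclusion of `Real34MeetAt`; MEETING lemma
+ projection + "restricted theta series are `U_Ψ`-classes" at the met level — `meet_of_theta` / `meet_of_cover`
build it from the two shapes the construction delivers).  As in E4, only `U_Ψ`-MEMBERSHIP is asked at the met level,
never membership in the model's `Θ(Γ)`, so no compatibility between the model's level groups `K_Γ` and the
sub-piece groups `K₁ ∩ kK_Pk⁻¹` of the meeting lemma is needed. -/
structure Real34FunBridge {L : CMField} {ι₁ : L →+* ℂ} (V : HermSpace3 L ι₁) (c : SeesawCtx L) where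
  /-- the global (34)-wedge-functions (D2 datum: antisymmetrised products of pairs of (34)-theta series, all levels) -/
  wset : Set (T.HG L ι₁ V)
  /-- Lemma 3.5 (34), FUNCTION form: `ϑ₃₄(χ, Φ) ∈ closure (span wset)` -/
  gen_mem : ∀ (χ : (T.t34 V c).X) (Φ : T.SK V c),
    (T.t34 V c).ϑ χ Φ ∈ (Submodule.span ℂ wset).topologicalClosure
  /-- MEETING: `⟪Λ_{Γ₁}(ω₁, ω₂), P⟫ ≠ 0`, `P ∈ wset`, `ωᵢ ∈ U_{Ψᵢ}(Γ₁)` ⇒ at some level `Γ` a (34)-wedge of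
  `U_Ψ`-classes pairs non-trivially with a (12)-wedge of `U_Ψ`-classes -/
  meet : ∀ (Γ₁ : Level V) (ω₁ ω₂ : U.CohC (U.pms L ι₁ V Γ₁) 1),
    ω₁ ∈ U.Uiso Γ₁ c.K (c.Ψ 0) c.σ → ω₂ ∈ U.Uiso Γ₁ c.K (c.Ψ 1) c.σ →
    ∀ P ∈ wset, ⟪T.Λ Γ₁ ω₁ ω₂, P⟫_ℂ ≠ 0 →
    ∃ (Γ : Level V) (ω : Fin 4 → U.CohC (U.pms L ι₁ V Γ) 1),
      (∀ i, ω i ∈ U.Uiso Γ c.K (c.Ψ i) c.σ) ∧ ⟪T.Λ Γ (ω 2) (ω 3), T.Λ Γ (ω 0) (ω 1)⟫_ℂ ≠ 0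

/-- **C6′ from the function-level (34)-bridge**: a (12)-wedge of `U_Ψ`-classes pairing non-trivially with
`ϑ₃₄(χ, Φ)` pairs non-trivially with some global (34)-wedge-function (closure-span lemma), hence — `meet` — at one
level with a (34)-wedge of `U_Ψ`-classes. -/
theorem real34MeetAt_of_funBridge {L : CMField} {ι₁ : L →+* ℂ} {V : HermSpace3 L ι₁} {c : SeesawCtx L}
    (B : T.Real34FunBridge V c) : T.Real34MeetAt V c := by
  intro χ Φ Γ₁ ω₁ ω₂ e₁ e₂ hne
  obtain ⟨P, hP, hΛP⟩ := StubTree.exists_inner_ne_zero_of_mem_closure_span hne (B.gen_mem χ Φ)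
  exact B.meet Γ₁ ω₁ ω₂ e₁ e₂ P hP hΛP

/-- `Nonempty` form of `real34MeetAt_of_funBridge`. -/
theorem real34MeetAt_of_nonempty_funBridge {L : CMField} {ι₁ : L →+* ℂ} {V : HermSpace3 L ι₁} {c : SeesawCtx L}
    (h : Nonempty (T.Real34FunBridge V c)) : T.Real34MeetAt V c :=
  h.elim fun B => T.real34MeetAt_of_funBridge B

/-- **The theta shape gives `meet`**: if every non-trivial pairing `⟪Λ_{Γ₁}(ω₁, ω₂), P⟫`, `P ∈ wset`, is met at some
level `Γ` by a (12)-pair of `U_Ψ`-classes `η₁, η₂` against the wedge of two THETA one-forms `ω₃ ∈ Θ₂(Γ)`,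
`ω₄ ∈ Θ₃(Γ)` of the model, then `meet` holds by C3 (`thetaSub` for the two (34) types at `(V, c)`). -/
theorem Real34FunBridge.meet_of_theta {L : CMField} {ι₁ : L →+* ℂ} {V : HermSpace3 L ι₁} {c : SeesawCtx L}
    (h₂ : ∀ Γ : Level V, T.Theta V c 2 Γ ⊆ U.Uiso Γ c.K (c.Ψ 2) c.σ)
    (h₃ : ∀ Γ : Level V, T.Theta V c 3 Γ ⊆ U.Uiso Γ c.K (c.Ψ 3) c.σ) (wset : Set (T.HG L ι₁ V))
    (h : ∀ (Γ₁ : Level V) (ω₁ ω₂ : U.CohC (U.pms L ι₁ V Γ₁) 1),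
      ω₁ ∈ U.Uiso Γ₁ c.K (c.Ψ 0) c.σ → ω₂ ∈ U.Uiso Γ₁ c.K (c.Ψ 1) c.σ →
      ∀ P ∈ wset, ⟪T.Λ Γ₁ ω₁ ω₂, P⟫_ℂ ≠ 0 →
      ∃ (Γ : Level V) (η₁ η₂ ω₃ ω₄ : U.CohC (U.pms L ι₁ V Γ) 1),
        η₁ ∈ U.Uiso Γ c.K (c.Ψ 0) c.σ ∧ η₂ ∈ U.Uiso Γ c.K (c.Ψ 1) c.σ ∧
        ω₃ ∈ T.Theta V c 2 Γ ∧ ω₄ ∈ T.Theta V c 3 Γ ∧ ⟪T.Λ Γ ω₃ ω₄, T.Λ Γ η₁ η₂⟫_ℂ ≠ 0) :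
    ∀ (Γ₁ : Level V) (ω₁ ω₂ : U.CohC (U.pms L ι₁ V Γ₁) 1),
      ω₁ ∈ U.Uiso Γ₁ c.K (c.Ψ 0) c.σ → ω₂ ∈ U.Uiso Γ₁ c.K (c.Ψ 1) c.σ →
      ∀ P ∈ wset, ⟪T.Λ Γ₁ ω₁ ω₂, P⟫_ℂ ≠ 0 →
      ∃ (Γ : Level V) (ω : Fin 4 → U.CohC (U.pms L ι₁ V Γ) 1),
        (∀ i, ω i ∈ U.Uiso Γ c.K (c.Ψ i) c.σ) ∧ ⟪T.Λ Γ (ω 2) (ω 3), T.Λ Γ (ω 0) (ω 1)⟫_ℂ ≠ 0 := by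
  intro Γ₁ ω₁ ω₂ e₁ e₂ P hP hne
  obtain ⟨Γ, η₁, η₂, ω₃, ω₄, hη₁, hη₂, hω₃, hω₄, hmeet⟩ := h Γ₁ ω₁ ω₂ e₁ e₂ P hP hne
  refine ⟨Γ, ![η₁, η₂, ω₃, ω₄], ?_, hmeet⟩
  intro i
  fin_cases i
  · exact hη₁
  · exact hη₂
  · exact h₂ Γ hω₃
  · exact h₃ Γ hω₄

/-- **The cover-pull-back shape gives `meet`** (E4 roadmap, C6′: on the contributing sub-piece the (12)-side is
`c₁ ×` the lift of `cover^*(ω₁ ∪ ω₂)`, the (34)-side the wedge of two restricted theta one-forms at `Γ' ≤ Γ₁`, which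
are `U_Ψ`-classes): if every non-trivial pairing `⟪Λ_{Γ₁}(ω₁, ω₂), P⟫`, `P ∈ wset`, is met at some `Γ ≤ Γ₁` by
`U_Ψ`-classes `ω₃, ω₄` of types `Ψ₂, Ψ₃` against the PULL-BACKS of `ω₁, ω₂` along `T.cover Γ₁ Γ`, then `meet` holds —
the pull-backs are `U_Ψ`-classes by `Universe.pullC_mem_Uiso` (model fact `Fact_pull_comp`). -/
theorem Real34FunBridge.meet_of_cover (hpc : U.Fact_pull_comp) {L : CMField} {ι₁ : L →+* ℂ} {V : HermSpace3 L ι₁}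
    {c : SeesawCtx L} (wset : Set (T.HG L ι₁ V))
    (h : ∀ (Γ₁ : Level V) (ω₁ ω₂ : U.CohC (U.pms L ι₁ V Γ₁) 1),
      ω₁ ∈ U.Uiso Γ₁ c.K (c.Ψ 0) c.σ → ω₂ ∈ U.Uiso Γ₁ c.K (c.Ψ 1) c.σ →
      ∀ P ∈ wset, ⟪T.Λ Γ₁ ω₁ ω₂, P⟫_ℂ ≠ 0 →
      ∃ (Γ : Level V) (hle : Γ.Γ ≤ Γ₁.Γ),
        ∃ ω₃ ∈ U.Uiso Γ c.K (c.Ψ 2) c.σ, ∃ ω₄ ∈ U.Uiso Γ c.K (c.Ψ 3) c.σ,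
        ⟪T.Λ Γ ω₃ ω₄,
          T.Λ Γ (U.pullC (T.cover Γ₁ Γ hle) 1 ω₁) (U.pullC (T.cover Γ₁ Γ hle) 1 ω₂)⟫_ℂ ≠ 0) :
    ∀ (Γ₁ : Level V) (ω₁ ω₂ : U.CohC (U.pms L ι₁ V Γ₁) 1),
      ω₁ ∈ U.Uiso Γ₁ c.K (c.Ψ 0) c.σ → ω₂ ∈ U.Uiso Γ₁ c.K (c.Ψ 1) c.σ →
      ∀ P ∈ wset, ⟪T.Λ Γ₁ ω₁ ω₂, P⟫_ℂ ≠ 0 →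
      ∃ (Γ : Level V) (ω : Fin 4 → U.CohC (U.pms L ι₁ V Γ) 1),
        (∀ i, ω i ∈ U.Uiso Γ c.K (c.Ψ i) c.σ) ∧ ⟪T.Λ Γ (ω 2) (ω 3), T.Λ Γ (ω 0) (ω 1)⟫_ℂ ≠ 0 := by
  intro Γ₁ ω₁ ω₂ e₁ e₂ P hP hne
  obtain ⟨Γ, hle, ω₃, hω₃, ω₄, hω₄, hmeet⟩ := h Γ₁ ω₁ ω₂ e₁ e₂ P hP hne
  refine ⟨Γ, ![U.pullC (T.cover Γ₁ Γ hle) 1 ω₁, U.pullC (T.cover Γ₁ Γ hle) 1 ω₂, ω₃, ω₄], ?_, hmeet⟩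
  intro i
  fin_cases i
  · exact U.pullC_mem_Uiso hpc (T.cover Γ₁ Γ hle) c.K (c.Ψ 0) c.σ e₁
  · exact U.pullC_mem_Uiso hpc (T.cover Γ₁ Γ hle) c.K (c.Ψ 1) c.σ e₂
  · exact hω₃
  · exact hω₄

/-- With `Fact_pull_cup` the (12)-side of the cover shape is the embedded pull-back of the CUP:
`Λ_Γ(cover^*ω₁, cover^*ω₂) = emb_Γ (cover^*(ω₁ ∪ ω₂))` (E4 roadmap; the form in which the meeting lemma reads the
(12)-side as ONE lifted function). -/
theorem Λ_pullC_cover (hcup : U.Fact_pull_cup) {L : CMField} {ι₁ : L →+* ℂ} {V : HermSpace3 L ι₁}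
    (Γ₁ Γ : Level V) (hle : Γ.Γ ≤ Γ₁.Γ) (ω₁ ω₂ : U.CohC (U.pms L ι₁ V Γ₁) 1) :
    T.Λ Γ (U.pullC (T.cover Γ₁ Γ hle) 1 ω₁) (U.pullC (T.cover Γ₁ Γ hle) 1 ω₂) =
      T.emb Γ (U.pullC (T.cover Γ₁ Γ hle) (1 + 1) (U.cup2C (U.pms L ι₁ V Γ₁) 1 ω₁ ω₂)) := by
  rw [T.Λ_apply, U.pullC_cup2C hcup]

/-! ## 3. The six-input record from the two bridges, and the headline -/

variable {T}

/-- **`AllCharsNonDesignPt₂ S` from C2, C3, C4, C7 and the two FUNCTION-LEVEL bridges** (each demanded only at good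
contexts of the class `S` and at the hermitian space at hand). -/
theorem AllCharsNonDesignPt₂.ofFunBridges {S : ∀ {L : CMField}, SeesawCtx L → Prop}
    (innerEmb : ∀ {L : CMField} {ι₁ : L →+* ℂ} (V : HermSpace3 L ι₁) (c : SeesawCtx L),
      T.GoodCtx ι₁ c → S c → T.InnerEmbAt V)
    (thetaSub : ∀ {L : CMField} {ι₁ : L →+* ℂ} (V : HermSpace3 L ι₁) (c : SeesawCtx L), T.GoodCtx ι₁ c → S c →
      ∀ (i : Fin 4) (Γ : Level V), T.Theta V c i Γ ⊆ U.Uiso Γ c.K (c.Ψ i) c.σ)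
    (thetaWedge : ∀ {L : CMField} {ι₁ : L →+* ℂ} (V : HermSpace3 L ι₁) (c : SeesawCtx L), T.GoodCtx ι₁ c → S c →
      ∃ Γ : Level V, ∃ ω₁ ∈ T.Theta V c 0 Γ, ∃ ω₂ ∈ T.Theta V c 1 Γ, U.cup2C (U.pms L ι₁ V Γ) 1 ω₁ ω₂ ≠ 0)
    (gen12 : ∀ {L : CMField} {ι₁ : L →+* ℂ} (V : HermSpace3 L ι₁) (c : SeesawCtx L), T.GoodCtx ι₁ c → S c →
      Nonempty (T.Gen12FunBridge V c))
    (real34 : ∀ {L : CMField} {ι₁ : L →+* ℂ} (V : HermSpace3 L ι₁) (c : SeesawCtx L), T.GoodCtx ι₁ c → S c →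
      Nonempty (T.Real34FunBridge V c))
    (occ : ∀ {L : CMField} {ι₁ : L →+* ℂ} (V : HermSpace3 L ι₁) (c : SeesawCtx L), T.GoodCtx ι₁ c → S c →
      (∀ (Φ : T.SK V c) (i : T.SigIdx V c),
          (∃ v ∈ (T.core V c).hatσ i, (T.core V c).TΦ Φ v ≠ 0) → (T.t12 V c).wOccurs i) ∧
        (∀ (Φ : T.SK V c) (i : T.SigIdx V c),
          (∃ v ∈ (T.core V c).hatσ i, (T.core V c).TΦ Φ v ≠ 0) → (T.t34 V c).wOccurs i)) :
    T.AllCharsNonDesignPt₂ S :=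
  ⟨innerEmb, thetaSub, thetaWedge,
    fun V c hc hS => T.gen12MeetAt_of_nonempty_funBridge (gen12 V c hc hS),
    fun V c hc hS => T.real34MeetAt_of_nonempty_funBridge (real34 V c hc hS),
    occ⟩

end ThetaModel

end Universe

/-! ### Headline over the function-level bridges -/

namespace Assembly

open HodgeCM.Universe (AdelicThetaCore₀ SideData ThetaModel ModelAxiomsPerL)

variable (U : Universe)

/-- **₁₀ over the FUNCTION-LEVEL bridges**: PerL from the five model facts, C2/C3/C4/C7 and, in place of C5′/C6′, the
two function-level bridge records at every good context of the class `S ⊇ sextic` — `perL_ofSignRecipe₁₀` with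
`AllCharsNonDesignPt₂.ofFunBridges`. -/
theorem perL_ofFunBridges₁₀ (M : U.ModelAxiomsPerL) (h : Bool) (C : U.AdelicThetaCore₀)
    (d12 d34 : ∀ {L : CMField}, SeesawCtx L → SideData L) {S : ∀ {L : CMField}, SeesawCtx L → Prop}
    (hS : ∀ {L : CMField} (c : SeesawCtx L), Module.finrank ℚ c.K = 6 → S c)
    (innerEmb : ∀ {L : CMField} {ι₁ : L →+* ℂ} (V : HermSpace3 L ι₁) (c : SeesawCtx L),
      (C.thetaModel h d12 d34).GoodCtx ι₁ c → S c → (C.thetaModel h d12 d34).InnerEmbAt V)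
    (thetaSub : ∀ {L : CMField} {ι₁ : L →+* ℂ} (V : HermSpace3 L ι₁) (c : SeesawCtx L),
      (C.thetaModel h d12 d34).GoodCtx ι₁ c → S c →
      ∀ (i : Fin 4) (Γ : Level V), (C.thetaModel h d12 d34).Theta V c i Γ ⊆ U.Uiso Γ c.K (c.Ψ i) c.σ)
    (thetaWedge : ∀ {L : CMField} {ι₁ : L →+* ℂ} (V : HermSpace3 L ι₁) (c : SeesawCtx L),
      (C.thetaModel h d12 d34).GoodCtx ι₁ c → S c →
      ∃ Γ : Level V, ∃ ω₁ ∈ (C.thetaModel h d12 d34).Theta V c 0 Γ,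
        ∃ ω₂ ∈ (C.thetaModel h d12 d34).Theta V c 1 Γ, U.cup2C (U.pms L ι₁ V Γ) 1 ω₁ ω₂ ≠ 0)
    (gen12 : ∀ {L : CMField} {ι₁ : L →+* ℂ} (V : HermSpace3 L ι₁) (c : SeesawCtx L),
      (C.thetaModel h d12 d34).GoodCtx ι₁ c → S c → Nonempty ((C.thetaModel h d12 d34).Gen12FunBridge V c))
    (real34 : ∀ {L : CMField} {ι₁ : L →+* ℂ} (V : HermSpace3 L ι₁) (c : SeesawCtx L),
      (C.thetaModel h d12 d34).GoodCtx ι₁ c → S c → Nonempty ((C.thetaModel h d12 d34).Real34FunBridge V c))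
    (occ : ∀ {L : CMField} {ι₁ : L →+* ℂ} (V : HermSpace3 L ι₁) (c : SeesawCtx L),
      (C.thetaModel h d12 d34).GoodCtx ι₁ c → S c →
      (∀ (Φ : (C.thetaModel h d12 d34).SK V c) (i : (C.thetaModel h d12 d34).SigIdx V c),
          (∃ v ∈ ((C.thetaModel h d12 d34).core V c).hatσ i, ((C.thetaModel h d12 d34).core V c).TΦ Φ v ≠ 0) →
          ((C.thetaModel h d12 d34).t12 V c).wOccurs i) ∧
        (∀ (Φ : (C.thetaModel h d12 d34).SK V c) (i : (C.thetaModel h d12 d34).SigIdx V c),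
          (∃ v ∈ ((C.thetaModel h d12 d34).core V c).hatσ i, ((C.thetaModel h d12 d34).core V c).TΦ Φ v ≠ 0) →
          ((C.thetaModel h d12 d34).t34 V c).wOccurs i))
    (hHR : U.Fact_hodgeRiemann20) : U.PerL :=
  perL_ofSignRecipe₁₀ U M h C d12 d34 hS
    (ThetaModel.AllCharsNonDesignPt₂.ofFunBridges innerEmb thetaSub thetaWedge gen12 real34 occ) hHR

end Assembly

end HodgeCM

end
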